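import Summits.Ventures.PercRepro.RankLevelSetN
import Summits.Ventures.PercRepro.RankLevelSetF
import Summits.Ventures.PercRepro.RankLevelSetBAll
import Summits.Ventures.PercRepro.MatroidMidCount

/-!
# PercRepro — Theorem N on every matroid: the `|E|`-induction wrapper (p2, gen 5)

`proofs/MINE2-RLS.md` §14 Step 0 / Step 1 + §15: for `p ≥ 4`, C-025 at `q = 2` holds on every finite matroid by
strong induction on `|E|`, simultaneously for all `p`:
* a LOOP halves both counts — the step `hloop` (typer-2 stamp 87 / p3's sum-form version, to be instantiated);
* a PARALLEL PAIR is Theorem F (p3's `c025_step_of_delete_contract` with `spans_of_parallel`) fed with the induction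
  hypothesis on `M ＼ {e}` at `(p, 2)` and THEOREM B at `(p − 1, 1)` on `M ／ {e}` — the step `hB` (p3's all-matroid
  Theorem B, to be instantiated);
* a COLOOP at `ρ(E) = p` is Lemma J₂ — the step `hcolo` (typer-2's (N3), to be instantiated; for `p ≥ 5` it uses the
  induction hypothesis on `M ＼ {e}` at `(p − 1, 2)`);
* `ρ(E) < p` makes `U(p, 2)` empty;
* otherwise `M` is simple with `ρ(E) ≥ p`, coloop-free when `ρ(E) = p`, and Step 2 applies (`c025_two_of_simple`).

`rls_two_all` is this induction with the three steps as named hypotheses; `c025_of_q_two` instantiates them with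
p3's `ncard_U_eq_two_mul_of_loop` / `ncard_Y_eq_two_mul_of_loop` (loops), typer-2's `sumForm_of_isColoop` /
`sumForm_of_isColoop_four` (Lemma J₂) and p3's `c025_of_q_one` (Theorem B): **C-025 at `q = 2` on every finite
matroid, every `p ≥ 4`**.  `RLS M p q` abbreviates the body of `C025` for one matroid.
-/

open scoped Matroid

namespace PercRepro

namespace ThmN

open Finset Set

variable {α : Type}

/-- The body of `C025` for one matroid and one pair `(p, q)`. -/
def RLS (M : Matroid α) [M.Finite] (p q : ℕ) : Prop :=
  phiK p q * ({A : Set α | A ⊆ M.E ∧ M.eRk A = (p : ℕ∞) ∧ M.eRk (M.E \ A) = (q : ℕ∞)}.ncard : ℚ) ≤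
    ({A : Set α | A ⊆ M.E ∧ (q : ℕ∞) < M.eRk A ∧ M.eRk A < (p : ℕ∞)}.ncard : ℚ)

/-- `RLS` holds trivially when `ρ(E) < p` (no set has rank `p`). -/
theorem RLS_of_eRank_lt (M : Matroid α) [M.Finite] {p q : ℕ} (h : M.eRank < (p : ℕ∞)) : RLS M p q := by
  unfold RLS
  have hempty : {A : Set α | A ⊆ M.E ∧ M.eRk A = (p : ℕ∞) ∧ M.eRk (M.E \ A) = (q : ℕ∞)} = ∅ := by
    rw [Set.eq_empty_iff_forall_notMem]
    rintro A ⟨-, hA, -⟩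
    have := M.eRk_le_eRank A
    rw [hA] at this
    exact absurd (this.trans_lt h) (lt_irrefl _)
  rw [hempty, Set.ncard_empty, Nat.cast_zero, mul_zero]
  positivity

/-- In a matroid without loops and without parallel pairs, two distinct points of the ground set have rank `2`. -/
theorem eRk_pair_eq_two_of_simple (M : Matroid α) [M.Finite]
    (hnoloop : ∀ e ∈ M.E, ¬ M.IsLoop e)
    (hnopar : ∀ e ∈ M.E, ∀ e' ∈ M.E, e' ≠ e → e ∉ M.closure {e'})
    {e f : α} (he : e ∈ M.E) (hf : f ∈ M.E) (hef : e ≠ f) : M.eRk {e, f} = 2 := by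
  have hf' : M.Indep {f} := Matroid.indep_singleton.2 ((Matroid.not_isLoop_iff hf).1 (hnoloop f hf))
  have hind : M.Indep (insert e {f}) := by
    rw [hf'.insert_indep_iff_of_notMem (by simpa using hef)]
    exact ⟨he, hnopar e he f hf hef.symm⟩
  rw [hind.eRk_eq_encard, Set.encard_pair hef]

/-- Theorem F's step at `(p, 2)`: a parallel pair reduces `RLS M p 2` to `RLS (M ＼ {e}) p 2` and
`RLS (M ／ {e}) (p − 1) 1`. -/
theorem RLS_of_parallel (M : Matroid α) [M.Finite] {p : ℕ} (hp : 1 ≤ p) {e e' : α} (he : M.Indep {e})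
    (he' : e' ∈ M.E) (hne : e' ≠ e) (hpar : e ∈ M.closure {e'})
    (h1 : RLS (M ＼ {e}) p 2) (h2 : RLS (M ／ {e}) (p - 1) 1) : RLS M p 2 := by
  have key := c025_step_of_delete_contract he (spans_of_parallel he' hne hpar) (p - 1) 1
  have hpp : p - 1 + 1 = p := Nat.sub_add_cancel hp
  unfold RLS at h1 h2 ⊢
  simp only [hpp, show (1 + 1 : ℕ) = 2 from rfl] at key
  exact key h1 h2

/-- **Theorem N on every matroid, modulo the three reduction steps**: with the loop step `hloop`, the coloop step
`hcolo` (Lemma J₂) and Theorem B at `q = 1` (`hB`), C-025 at `q = 2` holds for every finite matroid and every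
`p ≥ 4` — strong induction on `|E|` for all `p` at once, the simple coloop-free case being Step 2. -/
theorem rls_two_all
    (hloop : ∀ (M : Matroid α) [M.Finite] (e : α), M.IsLoop e → ∀ p : ℕ, RLS (M ＼ {e}) p 2 → RLS M p 2)
    (hcolo : ∀ (M : Matroid α) [M.Finite] (e : α) (p : ℕ), 4 ≤ p → M.IsColoop e → M.eRank = (p : ℕ∞) →
      (5 ≤ p → RLS (M ＼ {e}) (p - 1) 2) → RLS M p 2)
    (hB : ∀ (M : Matroid α) [M.Finite] (p : ℕ), 3 ≤ p → RLS M p 1) :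
    ∀ (M : Matroid α) [M.Finite] (p : ℕ), 4 ≤ p → RLS M p 2 := by
  suffices H : ∀ n : ℕ, ∀ (M : Matroid α) [M.Finite], M.E.ncard = n → ∀ p : ℕ, 4 ≤ p → RLS M p 2 from
    fun M _ p hp => H _ M rfl p hp
  intro n
  induction n using Nat.strong_induction_on with
  | _ n ih =>
  intro M _ hn p hp4
  classical
  have hdel : ∀ e ∈ M.E, (M ＼ {e}).E.ncard < n := by
    intro e he
    rw [Matroid.delete_ground, ← hn, ← Set.ncard_sdiff_singleton_add_one he M.ground_finite]
    omega
  -- Case 1: a loop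
  by_cases hL : ∃ e ∈ M.E, M.IsLoop e
  · obtain ⟨e, he, hloopE⟩ := hL
    exact hloop M e hloopE p (ih _ (hdel e he) (M ＼ {e}) rfl p hp4)
  push Not at hL
  -- Case 2: a parallel pair
  by_cases hP : ∃ e ∈ M.E, ∃ e' ∈ M.E, e' ≠ e ∧ e ∈ M.closure {e'}
  · obtain ⟨e, he, e', he', hne, hpar⟩ := hP
    have heI : M.Indep {e} := Matroid.indep_singleton.2 ((Matroid.not_isLoop_iff he).1 (hL e he))
    exact RLS_of_parallel M (by omega) heI he' hne hpar (ih _ (hdel e he) (M ＼ {e}) rfl p hp4)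
      (hB (M ／ {e}) (p - 1) (by omega))
  push Not at hP
  -- Case 3: simple
  have hs : ∀ e ∈ M.E, ∀ f ∈ M.E, e ≠ f → M.eRk {e, f} = 2 :=
    fun e he f hf hef => eRk_pair_eq_two_of_simple M hL (fun e he e' he' hne => hP e he e' he' hne) he hf hef
  rcases lt_or_ge M.eRank (p : ℕ∞) with hlt | hge
  · exact RLS_of_eRank_lt M hlt
  by_cases hC : M.eRank = (p : ℕ∞) ∧ ∃ e, M.IsColoop e
  · obtain ⟨hR, e, hcol⟩ := hC
    refine hcolo M e p hp4 hcol hR (fun hp5 => ih _ (hdel e hcol.mem_ground) (M ＼ {e}) rfl (p - 1) (by omega))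
  · have hcolfree : M.eRank = (p : ℕ∞) → ∀ e, ¬ M.IsColoop e := by
      intro hR e hcol
      exact hC ⟨hR, e, hcol⟩
    exact c025_two_of_simple M p hp4 hs hge hcolfree

/-! ### Instantiating the three steps -/

/-- The loop step at `(p, 2)` (p3's halving lemmas). -/
theorem RLS_of_loop (M : Matroid α) [M.Finite] {e : α} (he : M.IsLoop e) (p : ℕ)
    (h : RLS (M ＼ {e}) p 2) : RLS M p 2 := by
  unfold RLS at h ⊢
  have he' : e ∈ M.loops := he
  rw [ncard_U_eq_two_mul_of_loop he' p 2, ncard_Y_eq_two_mul_of_loop he' p 2]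
  push_cast at h ⊢
  linarith

/-- The coloop step at `ρ(E) = p` (typer-2's Lemma J₂). -/
theorem RLS_of_coloop (M : Matroid α) [M.Finite] {e : α} (p : ℕ) (hp4 : 4 ≤ p) (he : M.IsColoop e)
    (hR : M.eRank = (p : ℕ∞)) (hIH : 5 ≤ p → RLS (M ＼ {e}) (p - 1) 2) : RLS M p 2 := by
  rcases Nat.eq_or_lt_of_le hp4 with h4 | h5
  · subst h4
    have := Matroid.sumForm_of_isColoop_four (M := M) he hR
    exact this
  · obtain ⟨p', rfl⟩ : ∃ p', p = p' + 1 := ⟨p - 1, by omega⟩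
    have hIH' := hIH (by omega)
    rw [Nat.add_sub_cancel] at hIH'
    exact Matroid.sumForm_of_isColoop he (by omega) hR hIH'

/-- **Theorem N (mine-2, `MINE2-RLS.md` §14–§15): C-025 at `q = 2` on EVERY finite matroid, every `p ≥ 4`** —
`rls_two_all` with the three steps instantiated. -/
theorem c025_two_all (M : Matroid α) [M.Finite] (p : ℕ) (hp4 : 4 ≤ p) : RLS M p 2 :=
  rls_two_all (fun M _ _ he p h => RLS_of_loop M he p h)
    (fun M _ _ p hp4 he hR hIH => RLS_of_coloop M p hp4 he hR hIH)
    (fun M _ p _ => c025_of_q_one M p) M p hp4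

end ThmN

/-- **C-025 at `q = 2` for every finite matroid** (mine-2 Theorem N): for every `p ≥ 4`,
`phiK p 2 · #{A ⊆ E : ρ(A) = p, ρ(E ∖ A) = 2} ≤ #{A ⊆ E : 2 < ρ(A) < p}` — the body of `C025` at `q = 2`, no other
hypothesis. -/
theorem c025_of_q_two {α : Type} (M : Matroid α) [M.Finite] (p : ℕ) (hp4 : 4 ≤ p) :
    phiK p 2 * ({A : Set α | A ⊆ M.E ∧ M.eRk A = (p : ℕ∞) ∧ M.eRk (M.E \ A) = ((2 : ℕ) : ℕ∞)}.ncard : ℚ) ≤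
      ({A : Set α | A ⊆ M.E ∧ ((2 : ℕ) : ℕ∞) < M.eRk A ∧ M.eRk A < (p : ℕ∞)}.ncard : ℚ) := by
  have h := ThmN.c025_two_all M p hp4
  unfold ThmN.RLS at h
  exact h

end PercRepro
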